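import Mathlib
import HarnessLib
import Summits.Langlands.Langlands.Theses.QuarterDeficit1951
import Literature.NumberTheory.GaloisRepresentations.HeckeCharacterProofs
import Literature.NumberTheory.EllipticCurves.EisensteinNewformLevelRaisingInertiaLocalComponentProofs
import Literature.NumberTheory.Automorphic.LocalComponentBJExistsProofs
import Literature.NumberTheory.Automorphic.LocalComponentBJProofs
import Literature.NumberTheory.Automorphic.SGoodLevelEigenform
import Literature.NumberTheory.Automorphic.NewformAdelisationHeckeLocal
import Literature.NumberTheory.Automorphic.UnramifiedLevelChange

/-!
# Helper for stub `stub_levelOne` (crux stmt-Langlands-15898 `QuarterDeficit1951.CorrespondentFingerprint`,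
# line `Sketch`): the global assembly — from a local `K₁(𝔭)`-vector at ONE place to a global
# `K₁(𝔫)`-vector of `W / W'`

Support file (closes nothing; `--supports stmt-Langlands-15898`; registered sub-goal
`stub_levelOne_assembly`).  The registered stub `stub_levelOne` (LevelExactness) asks, for the
cuspidal correspondent `π` of an even icosahedral `ρ` of Artin conductor `1951`, for a vector of
`W ∖ W'` fixed modulo `W'` by the finite-adelic Hecke level group `K₁(1951)` (`gammaOneFiniteLevel`).
Its plan has three local inputs — sphericality of `π_v` at every `q_v ≠ 1951` (parts (A), (B):
`…StubLevelOneSpherical`, landed), and a `K₁(𝔭)`-fixed vector of `π_1951` (part (C), Casselman's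
conductor-one new vector, NOT in the tree) — and one global step, proved here WITHOUT the tensor
product theorem:

* `exists_fixed_finiteRep_of_local_of_away` (any `GL_n`, Borel–Jacquet model `W / W'`): for a finite
  place `w`, a compact `L ≤ GL_n(K_w)` and a level `KQ ≤ GL_n(𝔸_K^∞)` with `(KQ)_w ⊆ L` and
  `ι_w(L) ⊆ KQ`, a non-zero `L`-fixed vector in an irreducible local component `ρ` of `π` at `w` and
  a non-zero vector of `W / W'` fixed by the elements of `KQ` trivial at `w` give a non-zero vector of
  `W / W'` fixed by `KQ`.  Proof: the space `M` of vectors fixed by `{c ∈ KQ : c_w = 1}` is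
  `GL_n(K_w)`-stable; Flath's isotypic decomposition of `W / W'` along `ρ`
  (`exists_sum_intertwining_of_hasLocalComponentAt`, tree) gives an equivariant coordinate
  `p : W / W' → V_ρ` non-zero on `M`, hence ONTO the irreducible `ρ`; a preimage in `M` of the
  `L`-fixed vector, averaged over `L / N` (`N` of finite index fixing it: smoothness, `L` compact),
  is `L`-fixed, in `M`, and maps to `[L : N] x₀ ≠ 0`; and `KQ ⊆ ι_w(L) · {c ∈ KQ : c_w = 1}`.
* `exists_gammaOneFiniteLevel_fixed_of_local` (`GL₂`): with `L = K₁(𝔫)_w` (pull-back of `K₁(𝔫)`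
  under `ι_{w,f}`, compact open) and `KQ = K₁(𝔫)`; the away-from-`w` vector comes from a level
  `K(𝔪)` supported at `w` (`exists_principalCongruenceLevel_fixed_of_isUnramifiedAt`, `π` unramified
  at every `v ≠ w`).
* `exists_gammaOneFiniteLevel_1951_fixed_of_local`, `stub_levelOne_assembly` (`ℚ`, the place above
  `1951`, `primesEquiv`): the conclusion of `stub_levelOne` verbatim from sphericality at `q_v ≠ 1951`
  and the local `K₁(1951)_v`-vector at `q_v = 1951`.

No definitions; standard axioms; no named fact is assumed.

## References

* D. Flath, *Decomposition of representations into tensor products*, Corvallis 1979, Part 1,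
  Thm. 3–4. [FlathCorvallis1979]
* A. Borel, H. Jacquet, *Automorphic forms and automorphic representations*, Corvallis 1979,
  Part 1, §4.6. [BorelJacquetCorvallis1979]
* S. Gelbart, *Automorphic forms on adele groups* (1975), §3.A. [Gelbart1975]
* W. Casselman, *On some results of Atkin and Lehner*, Math. Ann. 201 (1973), Thm. 1. [Casselman1973]
-/

set_option linter.dupNamespace false -- project-wide option (lakefile weak.linter.dupNamespace); `Summit.Langlands.Langlands` is the mandated namespace

noncomputable section

open scoped MatrixGroups Matrix NumberField Classical
open Literature.NumberTheory.Automorphic Literature.NumberTheory.GaloisRepresentations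
  IsDedekindDomain NumberField
open Summit.Langlands Rat.HeightOneSpectrum

namespace Summit.Langlands.Langlands.Theorems.CorrespondentFingerprint

variable {n : ℕ} {K : Type} [Field K] [NumberField K] {hcpt : isCompact_glFiniteIntegralLevel n K}

set_option maxHeartbeats 1600000 in
/-- **Local-to-global transfer of a level vector (Flath's isotypy, Borel–Jacquet model).**  Let
`π = W / W'` be an automorphic representation of `GL_n(𝔸_K)`, `w` a finite place, `L ≤ GL_n(K_w)` a
compact subgroup and `KQ ≤ GL_n(𝔸_K^∞)` a subgroup whose `w`-components lie in `L` and which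
contains `ι_w(L)`.  Suppose an irreducible local component `ρ` of `π` at `w` has a non-zero
`L`-fixed vector `x₀`, and `W / W'` has a non-zero vector `y` fixed by the elements of `KQ` trivial
at `w`.  Then `W / W'` has a non-zero vector fixed by all of `KQ`.  Proof: the space `M` of vectors
fixed by the elements of `KQ` trivial at `w` is `GL_n(K_w)`-stable (these commute with `ι_w`) and
contains `y ≠ 0`; by the isotypic decomposition `y = ∑ eᵢ (pᵢ y)` along `ρ`
(`exists_sum_intertwining_of_hasLocalComponentAt`) some equivariant coordinate `pᵢ` is non-zero on
`M`, hence maps `M` ONTO the irreducible `ρ`; pick `m₀ ∈ M` over `x₀` and average it over `L / N`,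
`N` of finite index fixing `m₀` (smoothness, `L` compact): the average is `L`-fixed, lies in `M`,
and maps to `[L : N] x₀ ≠ 0`; finally `KQ ⊆ ι_w(L) · {c ∈ KQ : c_w = 1}`.
[cite: FlathCorvallis1979, Thm. 3 and Thm. 4] [cite: BorelJacquetCorvallis1979, §4.6] -/
theorem exists_fixed_finiteRep_of_local_of_away
    (π : AutomorphicRepData (AutomorphyDatum.gl n K hcpt)) (w : HeightOneSpectrum (𝓞 K))
    (L : Subgroup (GL (Fin n) (w.adicCompletion K)))
    (hLc : IsCompact (L : Set (GL (Fin n) (w.adicCompletion K))))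
    (KQ : Subgroup (GL (Fin n) (FiniteAdeleRing (𝓞 K) K)))
    (hKQw : ∀ u ∈ KQ, (AdelicGroupData.gl n K).toLocal w (GLn.ofFinite n K u) ∈ L)
    (hLKQ : ∀ m ∈ L, GLn.sndHom n K (GLn.ofLocal n K w m) ∈ KQ)
    {V : Type*} [AddCommGroup V] [Module ℂ V]
    (ρ : Representation ℂ (GL (Fin n) (w.adicCompletion K)) V) [ρ.IsIrreducible]
    (hloc : π.HasLocalComponentAt w ρ) {x₀ : V} (hx₀ : x₀ ≠ 0) (hxL : ∀ m ∈ L, ρ m x₀ = x₀)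
    {y : π.Quot} (hy : y ≠ 0)
    (hyfix : ∀ c : (AutomorphyDatum.gl n K hcpt).finiteAdelic,
      GLn.sndHom n K (c : (AdelicGroupData.gl n K).Adelic) ∈ KQ →
      (AdelicGroupData.gl n K).toLocal w (c : (AdelicGroupData.gl n K).Adelic) = 1 →
      π.finiteRep c y = y) :
    ∃ q : π.Quot, q ≠ 0 ∧ ∀ c : (AutomorphyDatum.gl n K hcpt).finiteAdelic,
      GLn.sndHom n K (c : (AdelicGroupData.gl n K).Adelic) ∈ KQ → π.finiteRep c q = q := by
  classical
  -- the local action `σ = finiteRep ∘ ι_w` on `W / W'`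
  have hιmem : ∀ t, GLn.ofLocal n K w t ∈ (AutomorphyDatum.gl n K hcpt).finiteAdelic := fun t =>
    GLn.ofLocal_mem_range_ofFinite w t
  let ιf : GL (Fin n) (w.adicCompletion K) →* (AutomorphyDatum.gl n K hcpt).finiteAdelic :=
    (GLn.ofLocal n K w).codRestrict _ hιmem
  let σ : Representation ℂ (GL (Fin n) (w.adicCompletion K)) π.Quot := π.finiteRep.comp ιf
  have hσ : ∀ t, σ t = π.finiteRep ⟨GLn.ofLocal n K w t, GLn.ofLocal_mem_range_ofFinite w t⟩ :=
    fun _ => rfl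
  -- the space `M` of vectors fixed by the elements of `KQ` trivial at `w`
  let M : Submodule ℂ π.Quot :=
    { carrier := {q | ∀ c : (AutomorphyDatum.gl n K hcpt).finiteAdelic,
        GLn.sndHom n K (c : (AdelicGroupData.gl n K).Adelic) ∈ KQ →
        (AdelicGroupData.gl n K).toLocal w (c : (AdelicGroupData.gl n K).Adelic) = 1 →
        π.finiteRep c q = q}
      zero_mem' := fun c _ _ => map_zero _
      add_mem' := fun {a b} ha hb c hc h1 => by
        change π.finiteRep c (a + b) = a + b
        rw [map_add, ha c hc h1, hb c hc h1]
      smul_mem' := fun r a ha c hc h1 => by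
        change π.finiteRep c (r • a) = r • a
        rw [map_smul, ha c hc h1] }
  have hM : ∀ q : π.Quot, q ∈ M ↔ ∀ c : (AutomorphyDatum.gl n K hcpt).finiteAdelic,
      GLn.sndHom n K (c : (AdelicGroupData.gl n K).Adelic) ∈ KQ →
      (AdelicGroupData.gl n K).toLocal w (c : (AdelicGroupData.gl n K).Adelic) = 1 →
      π.finiteRep c q = q := fun _ => Iff.rfl
  have hMσ : ∀ t, ∀ q ∈ M, σ t q ∈ M := by
    intro t q hq
    rw [hM]
    intro c hc h1
    rw [π.finiteRep_localRep_comm w σ hσ c h1, (hM q).1 hq c hc h1]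
  have hyM : y ∈ M := (hM y).2 hyfix
  -- isotypic decomposition of `y` along `ρ`
  obtain ⟨m, e, p, -, hp, hsum⟩ :=
    Literature.NumberTheory.EllipticCurves.Hida2000Thm326.exists_sum_intertwining_of_hasLocalComponentAt
      π w ρ hloc y
  obtain ⟨i, hi⟩ : ∃ i, p i y ≠ 0 := by
    by_contra h
    push Not at h
    apply hy
    rw [hsum]
    exact Finset.sum_eq_zero fun i _ => by rw [h i, map_zero]
  -- `p i` maps `M` onto `V`
  have hPM : ∀ x : V, ∃ q ∈ M, p i q = x := by
    let S : Subrepresentation ρ :=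
      ⟨M.map (p i), fun g x hx => by
        obtain ⟨q, hq, rfl⟩ := Submodule.mem_map.1 hx
        exact Submodule.mem_map.2 ⟨σ g q, hMσ g q hq, hp i g q⟩⟩
    have hS : S ≠ ⊥ := by
      intro h
      have hmem : p i y ∈ S.toSubmodule := Submodule.mem_map.2 ⟨y, hyM, rfl⟩
      rw [h] at hmem
      exact hi ((Submodule.mem_bot ℂ).1 hmem)
    have hStop : S = ⊤ := (IsSimpleOrder.eq_bot_or_eq_top S).resolve_left hS
    intro x
    have hx : x ∈ S.toSubmodule := by rw [hStop]; exact Submodule.mem_top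
    obtain ⟨q, hq, hqx⟩ := Submodule.mem_map.1 hx
    exact ⟨q, hq, hqx⟩
  obtain ⟨m₀, hm₀M, hm₀⟩ := hPM x₀
  -- a subgroup `N ≤ L` of finite index fixing `m₀` (smoothness)
  obtain ⟨φ₀, rfl⟩ := Submodule.Quotient.mk_surjective π.kerQuot m₀
  obtain ⟨U₀, hU₀, hfixU₀⟩ :=
    exists_isOpen_forall_rightTranslation_ofFinite_eq (π.stable.le_automorphicForms φ₀.2)
  let N : Subgroup L := (U₀.comap ((GLn.sndHom n K).comp (GLn.ofLocal n K w))).subgroupOf L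
  haveI hN : N.FiniteIndex :=
    Subgroup.finiteIndex_subgroupOf_of_isCompact_isOpen hLc
      (hU₀.preimage (GLn.continuous_sndHom.comp (GLn.continuous_ofLocal n K w)))
  have hNfix : ∀ u : L, u ∈ N →
      σ (u : GL (Fin n) (w.adicCompletion K)) (Submodule.Quotient.mk φ₀) =
        Submodule.Quotient.mk φ₀ := by
    intro u hu
    rw [π.localRep_mk w σ hσ]
    congr 1
    apply Subtype.ext
    have hu' : (u : GL (Fin n) (w.adicCompletion K)) ∈
        U₀.comap ((GLn.sndHom n K).comp (GLn.ofLocal n K w)) := Subgroup.mem_subgroupOf.1 hu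
    have h1 := hfixU₀ _ (Subgroup.mem_comap.1 hu')
    change rightTranslation (AdelicGroupData.gl n K)
      (GLn.ofFinite n K (GLn.sndHom n K (GLn.ofLocal n K w u))) (φ₀ : _ → ℂ) = φ₀ at h1
    rw [GLn.ofFinite_sndHom_ofLocal] at h1
    exact h1
  -- the average `m₁` of `m₀` over `L / N`
  haveI : Fintype (L ⧸ N) := Fintype.ofFinite _
  set m₁ : π.Quot := (∑ᶠ c : L ⧸ N, σ ((c.out : L) : GL (Fin n) (w.adicCompletion K)))
    (Submodule.Quotient.mk φ₀) with hm₁_def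
  have hm₁L : m₁ ∈ σ.fixedPoints L :=
    subgroupQuotientSum_apply_mem_fixedPoints_of_forall σ L N hNfix
  have hm₁eq : m₁ = ∑ c : L ⧸ N, σ ((c.out : L) : GL (Fin n) (w.adicCompletion K))
      (Submodule.Quotient.mk φ₀) := by
    rw [hm₁_def, finsum_eq_sum_of_fintype, LinearMap.sum_apply]
  have hm₁M : m₁ ∈ M := by
    rw [hm₁eq]
    exact M.sum_mem fun c _ => hMσ _ _ hm₀M
  have hpm₁ : p i m₁ = (Fintype.card (L ⧸ N) : ℂ) • x₀ := by
    rw [hm₁eq, map_sum]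
    have h1 : ∀ c : L ⧸ N, p i (σ ((c.out : L) : GL (Fin n) (w.adicCompletion K))
        (Submodule.Quotient.mk φ₀)) = x₀ := fun c => by
      rw [hσ, hp i, hm₀, hxL _ (c.out : L).2]
    simp_rw [h1]
    rw [Finset.sum_const, Finset.card_univ, ← Nat.cast_smul_eq_nsmul ℂ]
  have hm₁0 : m₁ ≠ 0 := by
    intro h
    rw [h, map_zero] at hpm₁
    exact smul_ne_zero (Nat.cast_ne_zero.2 Fintype.card_ne_zero) hx₀ hpm₁.symm
  refine ⟨m₁, hm₁0, fun c hc => ?_⟩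
  -- `c = ι_w(t) · c'` with `t = c_w ∈ L` and `c'` trivial at `w`
  obtain ⟨u, hu⟩ := c.2
  set t : GL (Fin n) (w.adicCompletion K) :=
    (AdelicGroupData.gl n K).toLocal w (c : (AdelicGroupData.gl n K).Adelic) with ht_def
  have htL : t ∈ L := by
    have h1 := hKQw _ hc
    rw [← hu, GLn.sndHom_ofFinite] at h1
    rw [ht_def, ← hu]
    exact h1
  let ιA : GL (Fin n) (w.adicCompletion K) →* (AdelicGroupData.gl n K).Adelic := GLn.ofLocal n K w
  have hιA : ∀ s, (ιf s : (AdelicGroupData.gl n K).Adelic) = ιA s := fun _ => rfl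
  have hιA1 : (AdelicGroupData.gl n K).toLocal w (ιA t) = t := GLn.toLocal_ofLocal t
  have hιA2 : GLn.sndHom n K (ιA t) ∈ KQ := hLKQ t htL
  set c' : (AutomorphyDatum.gl n K hcpt).finiteAdelic := (ιf t)⁻¹ * c with hc'_def
  have hc'coe : (c' : (AdelicGroupData.gl n K).Adelic) = (ιA t)⁻¹ * (c : (AdelicGroupData.gl n K).Adelic) := by
    rw [hc'_def, Subgroup.coe_mul, Subgroup.coe_inv, hιA]
  have hc'1 : (AdelicGroupData.gl n K).toLocal w (c' : (AdelicGroupData.gl n K).Adelic) = 1 := by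
    rw [hc'coe, map_mul, map_inv, hιA1, ← ht_def, inv_mul_cancel]
  have hc'KQ : GLn.sndHom n K (c' : (AdelicGroupData.gl n K).Adelic) ∈ KQ := by
    have h3 : GLn.sndHom n K ((ιA t)⁻¹ * (c : (AdelicGroupData.gl n K).Adelic)) =
        (GLn.sndHom n K (ιA t))⁻¹ * GLn.sndHom n K (c : (AdelicGroupData.gl n K).Adelic) := by
      rw [← map_inv]
      exact map_mul (GLn.sndHom n K) _ _
    rw [hc'coe, h3]
    exact mul_mem (inv_mem hιA2) hc
  have hsplit : c = ιf t * c' := by rw [hc'_def, mul_inv_cancel_left]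
  rw [hsplit, map_mul, Module.End.mul_apply, (hM m₁).1 hm₁M c' hc'KQ hc'1]
  exact (σ.mem_fixedPoints L m₁).1 hm₁L t htL


/-- **From a local `K₁(𝔫)_w`-vector to a global `K₁(𝔫)`-vector modulo `W'`** (`GL₂`).  Let
`π = W / W'` be an automorphic representation of `GL₂(𝔸_K)` unramified at every finite place
`v ≠ w`, and let an irreducible local component `ρ` of `π` at `w` have a non-zero vector fixed by
the local level `K₁(𝔫)_w = {m ∈ GL₂(𝒪_w) : m₂₁, (m⁻¹)₂₁, m₂₂ - 1 ∈ 𝔫𝒪_w}` (`IsLocK1 w 𝔫`).  Then some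
`φ ∈ W ∖ W'` is fixed modulo `W'` by the Hecke level group `K₁(𝔫) ≤ GL₂(𝔸_K^∞)`
(`gammaOneFiniteLevel`): a form of `W ∖ W'` of a level `K(𝔪)` supported at `w`
(`exists_principalCongruenceLevel_fixed_of_isUnramifiedAt`) is fixed by the elements of `K₁(𝔫)`
trivial at `w`, and `exists_fixed_finiteRep_of_local_of_away` applies with `L = K₁(𝔫)_w`
(compact open: `GLn.isCompact_isOpen_localLevel`, `isOpen_gammaOneFiniteLevel`).
[cite: FlathCorvallis1979, Thm. 3 and Thm. 4] [cite: Gelbart1975, §3.A] -/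
theorem exists_gammaOneFiniteLevel_fixed_of_local {hcpt : isCompact_glFiniteIntegralLevel 2 K}
    (π : AutomorphicRepData (AutomorphyDatum.gl 2 K hcpt)) (w : HeightOneSpectrum (𝓞 K))
    (𝔫 : Ideal (𝓞 K)) (hunr : ∀ v : HeightOneSpectrum (𝓞 K), v ≠ w → π.IsUnramifiedAt v)
    {V : Type*} [AddCommGroup V] [Module ℂ V]
    (ρ : Representation ℂ (GL (Fin 2) (w.adicCompletion K)) V) [ρ.IsIrreducible]
    (hloc : π.HasLocalComponentAt w ρ) {x₀ : V} (hx₀ : x₀ ≠ 0)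
    (hxfix : ∀ m : GL (Fin 2) (w.adicCompletion K), IsLocK1 w 𝔫 m → ρ m x₀ = x₀) :
    ∃ φ ∈ π.W, φ ∉ π.W' ∧ ∀ u ∈ gammaOneFiniteLevel K 𝔫,
      rightTranslation (AdelicGroupData.gl 2 K) (GLn.ofFinite 2 K u) φ - φ ∈ π.W' := by
  classical
  set KQ : Subgroup (GL (Fin 2) (FiniteAdeleRing (𝓞 K) K)) := gammaOneFiniteLevel K 𝔫 with hKQ
  set L : Subgroup (GL (Fin 2) (w.adicCompletion K)) :=
    KQ.comap ((GLn.sndHom 2 K).comp (GLn.ofLocal 2 K w)) ⊓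
      valuedCongruenceSubgroup (Fin 2) (1 : WithZero (Multiplicative ℤ)) with hL
  obtain ⟨hLc, -⟩ := GLn.isCompact_isOpen_localLevel 2 K w (U₁ := KQ) (isOpen_gammaOneFiniteLevel 𝔫)
  -- the local conditions of `K₁(𝔫)` and the local level `L`
  have hKQw : ∀ u ∈ KQ,
      Matrix.GeneralLinearGroup.map (AdelicGroupData.adeleEval K w) (GLn.ofFinite 2 K u) ∈ L := by
    intro u hu
    refine Subgroup.mem_inf.2 ⟨Subgroup.mem_comap.2 ?_, ?_⟩
    · rw [MonoidHom.comp_apply, mem_gammaOneFiniteLevel_iff_forall]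
      intro v
      rw [map_finiteAdeleEval_sndHom]
      by_cases hv : v = w
      · subst hv
        rw [GLn.map_adeleEval_ofLocal]
        have h1 := (mem_gammaOneFiniteLevel_iff_forall.1 hu) v
        rw [← GLn.sndHom_ofFinite (n := 2) (K := K) u, map_finiteAdeleEval_sndHom] at h1
        exact h1
      · rw [GLn.map_adeleEval_ofLocal_of_ne hv]
        exact isLocK1_one v 𝔫
    · exact toLocal_mem_valuedCongruenceSubgroup_one
        (GLn.ofFinite_mem_glIntegralLevel (gammaZeroFiniteLevel_le_glFiniteIntegralLevel 𝔫 hu.1)) w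
  have hLKQ : ∀ m ∈ L, GLn.sndHom 2 K (GLn.ofLocal 2 K w m) ∈ KQ := fun m hm =>
    Subgroup.mem_comap.1 (Subgroup.mem_inf.1 hm).1
  have hxL : ∀ m ∈ L, ρ m x₀ = x₀ := by
    intro m hm
    have h1 := (mem_gammaOneFiniteLevel_iff_forall.1 (hLKQ m hm)) w
    rw [map_finiteAdeleEval_sndHom, GLn.map_adeleEval_ofLocal] at h1
    exact hxfix m h1
  -- a form of level supported at `w`, fixed by the elements of `K₁(𝔫)` trivial at `w`
  obtain ⟨𝔪, h𝔪, h𝔪S, φ, hφW, hφW', hφfix⟩ :=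
    π.exists_principalCongruenceLevel_fixed_of_isUnramifiedAt ({w} : Set (HeightOneSpectrum (𝓞 K)))
      (fun v hv => hunr v fun h => hv (h ▸ rfl))
  set y : π.Quot := Submodule.Quotient.mk (p := π.kerQuot) ⟨φ, hφW⟩ with hy_def
  have hy : y ≠ 0 := fun h => hφW' ((Submodule.Quotient.mk_eq_zero π.kerQuot).1 h)
  have hyfix : ∀ c : (AutomorphyDatum.gl 2 K hcpt).finiteAdelic,
      GLn.sndHom 2 K (c : (AdelicGroupData.gl 2 K).Adelic) ∈ KQ →
      (AdelicGroupData.gl 2 K).toLocal w (c : (AdelicGroupData.gl 2 K).Adelic) = 1 →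
      π.finiteRep c y = y := by
    intro c hc h1
    have hcint : (c : (AdelicGroupData.gl 2 K).Adelic) ∈ glIntegralLevel 2 K := by
      obtain ⟨u, hu⟩ := c.2
      rw [← hu] at hc ⊢
      rw [GLn.sndHom_ofFinite] at hc
      exact GLn.ofFinite_mem_glIntegralLevel (gammaZeroFiniteLevel_le_glFiniteIntegralLevel 𝔫 hc.1)
    have hc𝔪 : (c : (AdelicGroupData.gl 2 K).Adelic) ∈ principalCongruenceLevel 2 K 𝔪 := by
      refine mem_principalCongruenceLevel_iff.2 ⟨hcint, fun v => ?_⟩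
      by_cases hv : v = w
      · subst hv
        rw [h1]
        exact one_mem _
      · rw [idealRadius_eq_one_of_not_dvd h𝔪 fun hd => hv (h𝔪S v hd)]
        exact toLocal_mem_valuedCongruenceSubgroup_one hcint v
    rw [hy_def, π.finiteRep_mk]
    congr 1
    exact Subtype.ext (hφfix _ hc𝔪)
  -- the transfer, and back to `W`
  obtain ⟨q, hq0, hqfix⟩ :=
    exists_fixed_finiteRep_of_local_of_away π w L hLc KQ (fun u hu => hKQw u hu) hLKQ ρ hloc hx₀ hxL
      hy hyfix
  obtain ⟨φ₁, rfl⟩ := Submodule.Quotient.mk_surjective π.kerQuot q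
  refine ⟨φ₁, φ₁.2, fun h => hq0 ((Submodule.Quotient.mk_eq_zero π.kerQuot).2 h), fun u hu => ?_⟩
  have h1 := hqfix ⟨GLn.ofFinite 2 K u, u, rfl⟩ (by rwa [GLn.sndHom_ofFinite])
  rw [π.finiteRep_mk, Submodule.Quotient.eq] at h1
  exact h1


/-! ## The crux-level composition over `ℚ` at `1951` -/

/-- **`stub_levelOne` from sphericality away from `1951` and the local statement at `1951`.**  For a
cuspidal `π` on `GL₂(𝔸_ℚ)` unramified at every finite `v` with `q_v ≠ 1951` (for the correspondent
of the crux this is `stub_levelOne_spherical` / `isUnramifiedAt_of_corresponds_of_residueCard_ne`):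
IF some irreducible smooth local component `π_v` of `π` at the place `v` with `q_v = 1951` has a
non-zero vector fixed by the local level `K₁(1951)_v` (`IsLocK1 v (1951)`), THEN `π` has a vector of
`W ∖ W'` fixed modulo `W'` by the Hecke level group `K₁(1951) ≤ GL₂(𝔸_ℚ^∞)`
(`exists_gammaOneFiniteLevel_fixed_of_local` at the place `w` of `ℚ` above `1951`,
`primesEquiv`).  The remaining LOCAL input is Casselman's conductor-one new vector for
`rec_v(π_v) ≅ ψ₁ ⊕ ψ₂`, `a(ψ₁) = 0`, `a(ψ₂) = 1`.
[cite: FlathCorvallis1979, Thm. 3 and Thm. 4] [cite: Casselman1973, Thm. 1] -/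
theorem exists_gammaOneFiniteLevel_1951_fixed_of_local {hcpt : isCompact_glFiniteIntegralLevel 2 ℚ}
    (π : CuspidalAutomorphicRepData 2 ℚ hcpt)
    (hsph : ∀ v : HeightOneSpectrum (𝓞 ℚ), v.residueCard ≠ 1951 → π.1.IsUnramifiedAt v)
    (hlocal : ∀ v : HeightOneSpectrum (𝓞 ℚ), v.residueCard = 1951 →
      ∃ (πv : SmoothIrrep (GL (Fin 2) (v.adicCompletion ℚ))) (x₀ : πv.V),
        π.1.HasLocalComponentAt v πv.ρ ∧ x₀ ≠ 0 ∧
          ∀ m : GL (Fin 2) (v.adicCompletion ℚ), IsLocK1 v (Ideal.span {(1951 : 𝓞 ℚ)}) m →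
            πv.ρ m x₀ = x₀) :
    ∃ φ ∈ π.1.W, φ ∉ π.1.W' ∧
      ∀ u ∈ gammaOneFiniteLevel ℚ (Ideal.span {(1951 : 𝓞 ℚ)}),
        rightTranslation (AdelicGroupData.gl 2 ℚ)
            (show (AdelicGroupData.gl 2 ℚ).Adelic from GLn.ofFinite 2 ℚ u) φ - φ ∈ π.1.W' := by
  classical
  -- the place `w` of `ℚ` above `1951`
  have hp : Nat.Prime 1951 := by norm_num
  set w : HeightOneSpectrum (𝓞 ℚ) := (primesEquiv (R := 𝓞 ℚ)).symm ⟨1951, hp⟩ with hw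
  have hwp : natGenerator w = 1951 := by
    have h1 := (primesEquiv (R := 𝓞 ℚ)).apply_symm_apply ⟨1951, hp⟩
    rw [← hw] at h1
    exact congrArg Subtype.val h1
  have hwq : w.residueCard = 1951 := by rw [Rat.residueCard_eq_natGenerator, hwp]
  have hne : ∀ v : HeightOneSpectrum (𝓞 ℚ), v ≠ w → v.residueCard ≠ 1951 := by
    intro v hv h
    apply hv
    apply Rat.natGenerator_injective
    rw [hwp, ← Rat.residueCard_eq_natGenerator, h]
  -- the local vector at `w`, and the assembly
  obtain ⟨πv, x₀, hloc, hx₀, hxfix⟩ := hlocal w hwq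
  haveI := πv.isIrreducible
  exact exists_gammaOneFiniteLevel_fixed_of_local π.1 w (Ideal.span {(1951 : 𝓞 ℚ)})
    (fun v hv => hsph v (hne v hv)) πv.ρ hloc hx₀ hxfix

/-- **Registered sub-goal `stub_levelOne_assembly` of `stub_levelOne`** (closed form of
`exists_gammaOneFiniteLevel_1951_fixed_of_local`): the global assembly of `stub_levelOne` from its
two local inputs — sphericality at every `q_v ≠ 1951` (`stub_levelOne_spherical`) and a non-zero
`K₁(1951)_v`-fixed vector in an irreducible smooth local component of `π` at `q_v = 1951` — to a
vector of `W ∖ W'` fixed modulo `W'` by the finite-adelic Hecke level group `K₁(1951)`.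
[cite: FlathCorvallis1979, Thm. 3 and Thm. 4] [cite: Gelbart1975, §3.A] -/
theorem stub_levelOne_assembly : ∀ (hcpt : isCompact_glFiniteIntegralLevel 2 ℚ)
    (π : CuspidalAutomorphicRepData 2 ℚ hcpt),
    (∀ v : HeightOneSpectrum (𝓞 ℚ), v.residueCard ≠ 1951 → π.1.IsUnramifiedAt v) →
    (∀ v : HeightOneSpectrum (𝓞 ℚ), v.residueCard = 1951 →
      ∃ (πv : SmoothIrrep (GL (Fin 2) (v.adicCompletion ℚ))) (x₀ : πv.V),
        π.1.HasLocalComponentAt v πv.ρ ∧ x₀ ≠ 0 ∧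
          ∀ m : GL (Fin 2) (v.adicCompletion ℚ), IsLocK1 v (Ideal.span {(1951 : 𝓞 ℚ)}) m →
            πv.ρ m x₀ = x₀) →
    ∃ φ ∈ π.1.W, φ ∉ π.1.W' ∧
      ∀ u ∈ gammaOneFiniteLevel ℚ (Ideal.span {(1951 : 𝓞 ℚ)}),
        rightTranslation (AdelicGroupData.gl 2 ℚ)
            (show (AdelicGroupData.gl 2 ℚ).Adelic from GLn.ofFinite 2 ℚ u) φ - φ ∈ π.1.W' :=
  fun _ π hsph hlocal => exists_gammaOneFiniteLevel_1951_fixed_of_local π hsph hlocal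

end Summit.Langlands.Langlands.Theorems.CorrespondentFingerprint

end
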